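import Summits.Ventures.HSemireg.UntwistCocycleTwistEquivalence
import Summits.Ventures.HSemireg.UntwistCocycleTwistLocal
import Summits.Ventures.HSemireg.UntwistComplexSigma
import HarnessLib

/-!
# Venture HSemireg — route R1.0 (untwisted reading) with the twist functor CONSTRUCTED: `θ` is a real,
# bijective map at the sheaf and at the complex level (th-4 file #13; sequel of files #11, #12, #14)

HONEST FRAMING. Instantiation of the th-4 kernel clauses (`UntwistExtEquivalence.lean` file #3, `UntwistDerivedTheta.lean`
#6, `UntwistDerivedAdjunction.lean` #7, `UntwistComplexSigma.lean` #10) at the CONSTRUCTED autoequivalence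
`Φ := CocycleTwist.twistEquivalence X c` («`- ⊗ M`», `M = lineBundle c`, files #11/#12). Nothing is asserted about any
variety; no gerbe; nothing here says HC, HC_CM or HC_AV is proved.

WHAT CHANGES. In the untwisted reading of record (lead R-49(a)/R-51(a): `E₀′ = E₀ ⊗ M_B` on `X₀` itself, on the fibres
where the `B`-field class is integral — t-12: `m` even) the identification of route R1.0 (i),
`θ : Ext²_{X₀}(E₀, E₀) → Ext²_{X₀}(E₀ ⊗ M_B, E₀ ⊗ M_B)` (by value `18 → 18` at the `g = 4` anchor), was so far
`Φ.functor.mapExtAddHom` resp. `x ↦ Ψ x ≫ (Ψ.commShiftIso 2)_{E₀}` for a BINDER `Φ` / `Ψ` («intended `- ⊗ M_B`»,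
«existence not asserted»). Here `Φ = twistEquivalence X₀ c` and `Ψ = D(Φ.functor)` (Mathlib's
`Functor.mapDerivedCategory` of the exact functor `- ⊗ M`) are CONSTRUCTED, and:

1. `mapExtAddHom_twist_bijective` — `Extⁿ(E, E′) → Extⁿ(E ⊗ M, E′ ⊗ M)` is bijective for ALL `𝒪_X`-modules `E, E′`
   and all `n` (file #3 at `Φ`; enough injectives in `Mod(𝒪_X)`, tree instance).
2. `isISemiregular_iff_twist` / `isISemiregular_univ_iff_twist` — REAL `σ_q = sigmaHigher` on both sides, `E` finite
   locally free (then so is `E ⊗ M := twist c E`: `isFiniteLocallyFree_twist`, file #14), `d_q = id` (same `X₀`,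
   `rk M = 1`): `I`-semiregularity of `E` iff of `E ⊗ M`, GIVEN the triangular re-expansion `hσ` (the Leibniz rule
   `At(E ⊗ M) = At(E) ⊗ 1 + 1 ⊗ At(M)`, Atiyah 1957 Prop. 10–12 — STILL A BINDER: the tree has no Leibniz rule on real
   carriers) — now the ONLY remaining binder at the sheaf level.
3. `twist_theta_bijective` — on complex carriers `θ x = Ψ x ≫ (Ψ.commShiftIso n)_B :
   Hom_{D(X₀)}(A, B⟦n⟧) → Hom(ΨA, (ΨB)⟦n⟧)` is bijective for ALL `A, B, n` (files #6/#7: `D` of an additive equivalence is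
   full and faithful), in particular at `A = B = Q E₀`, `n = 2` for ANY cochain complex `E₀` — the two-term STEP-0 object
   (`H⁻¹ = K`, `H⁰ = 𝒪_{X×0̂}`, not locally free) included: the hypothesis `hθ` of file #10 §1 is DISCHARGED.
4. `isISemiregularC_iff_jointlyInjective_twist` — file #10 §1 at `Ψ`: for `E₀` STRICTLY PERFECT (the K2 chain's REAL
   `HomComplex.sigmaC`), `E₀′ := Ψ(Q E₀) = (Q E₀) ⊗ᴸ M` in `D(Mod 𝒪_{X₀})`, any additive components `σ′_q` of `E₀′`
   re-expanding the `σ_q` through the constructed `θ` triangularly on a lower set `I` with injective diagonals: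
   `IsISemiregularC X₀ E₀ a b hK I ↔ (σ′_q)_{q ∈ I}` jointly injective.
5. `cocycleTwistComplex c E₀ = E₀ ⊗ M` termwise (strictly perfect if `E₀` is: `isFiniteLocallyFree_cocycleTwistComplex_X`, the
   `IsStrictlyGE/LE` instances), `twistTheta c E₀ n : Hom(Q E₀, (Q E₀)⟦n⟧) ≃+ Hom(Q(E₀ ⊗ M), Q(E₀ ⊗ M)⟦n⟧)` CONSTRUCTED
   (`θ` conjugated by `mapDerivedCategoryFactors`), and `isISemiregularC_iff_isISemiregularC_twist` — file #10 §4 with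
   BOTH sides the tree's real `IsISemiregularC`, `θ₀ := twistTheta`, `d = id`: `IsISemiregularC(E₀) ↔ IsISemiregularC(E₀ ⊗ M)`
   GIVEN ONLY the Leibniz re-expansion `hσ`.

What stays declared after this file (route R1.0, untwisted reading): the Leibniz rule / BF algebra `A_E` on real
carriers (binder `hσ`), and everything on the
gerbe side (odd `m`: no untwisted representative; `π^*`, tameness, `d_q = π^*`). Which Ext groups: `Ext²_{𝒪_{X₀}}(E₀,E₀)`
and `Hom_{D(X₀)}(Q E₀, (Q E₀)⟦2⟧)`; which class: `ch(E₀ ⊗ M_B) = ch(E₀)·exp(B)` (`UntwistKappaClass.lean`); which twist: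
`- ⊗ M_B`, `M_B = lineBundle c`.

## References

* [BuchweitzFlenner2003] R.-O. Buchweitz, H. Flenner, Compositio Math. 137 (2003), Def. 4.1, §5 (`I`-semiregular).
* [Atiyah1957] M. F. Atiyah, Trans. AMS 85 (1957), Prop. 10–12 (the binder that remains).
* [StacksProject] Tag 01CR (invertible modules). [Hartshorne1977] III.2.2 (enough injectives), III Ex. 4.5.
-/

open CategoryTheory CategoryTheory.Abelian AlgebraicGeometry

namespace Summit.Ventures.HSemireg

open Literature.AlgebraicGeometry.Modules Literature.AlgebraicGeometry.Motives
  Literature.AlgebraicGeometry.HodgeTheory CocycleTwist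

/-! ### 1. Sheaf carriers: `Ext` along `- ⊗ M` is bijective -/

section Sheaf

universe w u

variable {X : Scheme.{u}} [HasExt.{w} X.Modules] (c : UnitCocycle X)

/-- **R1.0 (i), untwisted reading, CONSTRUCTED: `Extⁿ(E, E′) → Extⁿ(E ⊗ M, E′ ⊗ M)` is bijective** for the cocycle
twist `- ⊗ M = (twistEquivalence X c).functor` and all `𝒪_X`-modules `E`, `E′` (no local freeness), all `n`.
[cite: Hartshorne1977, III.2.2 (enough injectives in Mod(O_X))] -/
theorem mapExtAddHom_twist_bijective (E E' : X.Modules) (n : ℕ) :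
    Function.Bijective ((twistEquivalence X c).functor.mapExtAddHom E E' n) :=
  mapExtAddHom_bijective_of_equivalence (twistEquivalence X c) E E' n

end Sheaf

/-! ### 2. Sheaf carriers, real `σ_q` of a finite locally free sheaf: `E` vs `E ⊗ M` -/

section SheafSigma

universe w u

variable {S : Type u} [CommRing S] {X : Over (Spec (CommRingCat.of S))} [HasExt.{w} X.left.Modules]
  (c : UnitCocycle X.left) {E : X.left.Modules} (hE : IsFiniteLocallyFree E)

/-- **`I`-semiregularity of `E` iff of `E ⊗ M`, real `σ_q` on both sides, `θ` CONSTRUCTED** (`Φ = twistEquivalence`,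
`E ⊗ M = twist c E` finite locally free by `isFiniteLocallyFree_twist`, `d_q = id`): file #3's
`isISemiregular_iff_of_equivalence` at the cocycle twist. The ONE binder left: the triangular re-expansion `hσ` (the
Leibniz rule; `u` arbitrary). [cite: BuchweitzFlenner2003, §5 (I-semiregular); Atiyah1957, Prop. 10–12] -/
theorem isISemiregular_iff_twist
    (u : ∀ q j, hodgeCohomology X j (j + 2) →+ hodgeCohomology X q (q + 2))
    {I : Set ℕ} (hI : IsLowerSet I)
    (hσ : ∀ q ∈ I, ∀ x : Ext.{w} E E 2,
      sigmaHigher (isFiniteLocallyFree_twist c hE) q ((twistEquivalence X.left c).functor.mapExtAddHom E E 2 x) =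
        sigmaHigher hE q x + ∑ j ∈ Finset.range q, u q j (sigmaHigher hE j x)) :
    IsISemiregular.{w} hE I ↔ IsISemiregular.{w} (isFiniteLocallyFree_twist c hE) I :=
  isISemiregular_iff_of_equivalence (twistEquivalence X.left c) hE (isFiniteLocallyFree_twist c hE)
    (fun _ => AddMonoidHom.id _) u hI (fun _ _ => Function.injective_id) fun q hq x => hσ q hq x

/-- **FULL semiregularity of `E` iff of `E ⊗ M`** (`I = univ`), `θ` constructed, `E ⊗ M` finite locally free proved.
[cite: BuchweitzFlenner2003, Def. 4.1 and §5] -/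
theorem isISemiregular_univ_iff_twist
    (u : ∀ q j, hodgeCohomology X j (j + 2) →+ hodgeCohomology X q (q + 2))
    (hσ : ∀ (q : ℕ) (x : Ext.{w} E E 2),
      sigmaHigher (isFiniteLocallyFree_twist c hE) q ((twistEquivalence X.left c).functor.mapExtAddHom E E 2 x) =
        sigmaHigher hE q x + ∑ j ∈ Finset.range q, u q j (sigmaHigher hE j x)) :
    IsISemiregular.{w} hE Set.univ ↔ IsISemiregular.{w} (isFiniteLocallyFree_twist c hE) Set.univ :=
  isISemiregular_iff_twist c hE u isLowerSet_univ fun q _ => hσ q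

end SheafSigma

/-! ### 3. Complex carriers: `θ = D(- ⊗ M)` on `Hom_{D(X₀)}(A, B⟦n⟧)` is bijective; file #10 §1 with `hθ` discharged -/

section Complex

universe w u

variable {S : Type u} [CommRing S] {X₀ : Over (Spec (CommRingCat.of S))} [HasDerivedCategory.{w} X₀.left.Modules]
  (c : UnitCocycle X₀.left)

/-- **`θ` on complex carriers, CONSTRUCTED and bijective**: for `Ψ = D(- ⊗ M)` (Mathlib's `mapDerivedCategory` of the
exact functor `(twistEquivalence X₀ c).functor`), `x ↦ Ψ x ≫ (Ψ.commShiftIso n)_B : Hom(A, B⟦n⟧) → Hom(ΨA, (ΨB)⟦n⟧)` is a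
bijection for all `A, B ∈ D(Mod 𝒪_{X₀})`, all `n` — `D` of an additive equivalence is full and faithful (file #7) and
file #6's `map_comp_commShiftIso_bijective`. At `A = B = Q E₀`, `n = 2` this is R1.0 (i) for ANY cochain complex `E₀`.
[cite: GortzWedhorn2023, Prop. F.191; Orlov2002DerivedAbelian, p. 3 L33–40] -/
theorem twist_theta_bijective (A B : DerivedCategory X₀.left.Modules) (n : ℤ) :
    Function.Bijective (fun x : A ⟶ B⟦n⟧ => (twistEquivalence X₀.left c).functor.mapDerivedCategory.map x ≫
      (((twistEquivalence X₀.left c).functor.mapDerivedCategory.commShiftIso n).app B).hom) := by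
  haveI := full_mapDerivedCategory_of_equivalence (twistEquivalence X₀.left c)
  haveI := faithful_mapDerivedCategory_of_equivalence (twistEquivalence X₀.left c)
  exact map_comp_commShiftIso_bijective _ A B n

variable (E₀ : CochainComplex X₀.left.Modules ℤ) (a b : ℤ) [E₀.IsStrictlyGE a] [E₀.IsStrictlyLE b]
  (hK : ∀ p, IsFiniteLocallyFree (E₀.X p))
  {W' : ℕ → Type*} [∀ q, AddCommGroup (W' q)]
  (σ' : ∀ q, ((twistEquivalence X₀.left c).functor.mapDerivedCategory.obj (DerivedCategory.Q.obj E₀) ⟶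
    ((twistEquivalence X₀.left c).functor.mapDerivedCategory.obj (DerivedCategory.Q.obj E₀))⟦(2 : ℤ)⟧) →+ W' q)

/-- **R1.0 kernel clause for a STRICTLY PERFECT `E₀`, REAL source `σ_q`, `θ = D(- ⊗ M)` CONSTRUCTED** (file #10 §1 with its
hypothesis `hθ` discharged by `twist_theta_bijective`): `E₀′ := Ψ(Q E₀)` the derived twist of `E₀`, `σ′_q` any additive
components on `Hom(E₀′, E₀′⟦2⟧)` re-expanding `HomComplex.sigmaC X₀ E₀ a b hK` through `θ` triangularly on a LOWER set `I`
with injective diagonals `d_q` (intended `id`); then `IsISemiregularC X₀ E₀ a b hK I ↔ (σ′_q)_{q ∈ I}` jointly injective.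
[cite: BuchweitzFlenner2003, Def. 4.1 and §5 (I-semiregular)] -/
theorem isISemiregularC_iff_jointlyInjective_twist
    (d : ∀ q, ShiftedHom (DerivedCategory.Q.obj ((HomologicalComplex.single X₀.left.Modules (ComplexShape.up ℤ) 0).obj
        (unitModule X₀.left))) (DerivedCategory.Q.obj ((HomologicalComplex.single X₀.left.Modules (ComplexShape.up ℤ)
        0).obj (hodgeSheaf X₀ q))) ((q + 2 : ℕ) : ℤ) →+ W' q)
    (u : ∀ q j, ShiftedHom (DerivedCategory.Q.obj ((HomologicalComplex.single X₀.left.Modules (ComplexShape.up ℤ) 0).obj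
        (unitModule X₀.left))) (DerivedCategory.Q.obj ((HomologicalComplex.single X₀.left.Modules (ComplexShape.up ℤ)
        0).obj (hodgeSheaf X₀ j))) ((j + 2 : ℕ) : ℤ) →+ W' q)
    {I : Set ℕ} (hI : IsLowerSet I) (hd : ∀ q ∈ I, Function.Injective (d q))
    (hσ : ∀ q ∈ I, ∀ x : DerivedCategory.Q.obj E₀ ⟶ (DerivedCategory.Q.obj E₀)⟦(2 : ℤ)⟧,
      σ' q ((twistEquivalence X₀.left c).functor.mapDerivedCategory.map x ≫
        (((twistEquivalence X₀.left c).functor.mapDerivedCategory.commShiftIso (2 : ℤ)).app _).hom) =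
        d q (HomComplex.sigmaC X₀ E₀ a b hK q x) + ∑ j ∈ Finset.range q, u q j (HomComplex.sigmaC X₀ E₀ a b hK j x)) :
    HomComplex.IsISemiregularC X₀ E₀ a b hK I ↔
      ∀ x' : (twistEquivalence X₀.left c).functor.mapDerivedCategory.obj (DerivedCategory.Q.obj E₀) ⟶
          ((twistEquivalence X₀.left c).functor.mapDerivedCategory.obj (DerivedCategory.Q.obj E₀))⟦(2 : ℤ)⟧,
        (∀ q ∈ I, σ' q x' = 0) → x' = 0 :=
  isISemiregularC_iff_jointlyInjective_of_bijective_commShift E₀ a b hK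
    (twistEquivalence X₀.left c).functor.mapDerivedCategory σ' (twist_theta_bijective c _ _ 2) d u hI hd hσ

end Complex

/-! ### 4. Complex carriers, BOTH sides the tree's real predicate: `E₀` vs `E₀ ⊗ M` termwise, `θ₀` CONSTRUCTED -/

section ComplexBothSides

universe w u

variable {S : Type u} [CommRing S] {X₀ : Over (Spec (CommRingCat.of S))}
  (c : UnitCocycle X₀.left) (E₀ : CochainComplex X₀.left.Modules ℤ)

/-- **`E₀ ⊗ M` for a cochain complex `E₀`**: the cocycle twist applied termwise (Mathlib's `mapHomologicalComplex` of
the additive functor `- ⊗ M`). [folklore] -/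
noncomputable abbrev cocycleTwistComplex : CochainComplex X₀.left.Modules ℤ :=
  ((twistEquivalence X₀.left c).functor.mapHomologicalComplex (ComplexShape.up ℤ)).obj E₀

/-- The terms of `E₀ ⊗ M` are the twists of the terms. [folklore] -/
theorem cocycleTwistComplex_X (p : ℤ) : (cocycleTwistComplex c E₀).X p = twist c (E₀.X p) := rfl

variable {E₀} in
/-- **`E₀ ⊗ M` is termwise finite locally free if `E₀` is** (`isFiniteLocallyFree_twist`, file #14). [folklore] -/
theorem isFiniteLocallyFree_cocycleTwistComplex_X (hK : ∀ p, IsFiniteLocallyFree (E₀.X p)) (p : ℤ) :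
    IsFiniteLocallyFree ((cocycleTwistComplex c E₀).X p) :=
  isFiniteLocallyFree_twist c (hK p)

/-- `E₀ ⊗ M` is concentrated where `E₀` is (lower bound). [folklore] -/
instance cocycleTwistComplex_isStrictlyGE (a : ℤ) [E₀.IsStrictlyGE a] : (cocycleTwistComplex c E₀).IsStrictlyGE a :=
  inferInstanceAs (HomologicalComplex.IsStrictlySupported _ _)

/-- `E₀ ⊗ M` is concentrated where `E₀` is (upper bound). [folklore] -/
instance cocycleTwistComplex_isStrictlyLE (b : ℤ) [E₀.IsStrictlyLE b] : (cocycleTwistComplex c E₀).IsStrictlyLE b :=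
  inferInstanceAs (HomologicalComplex.IsStrictlySupported _ _)

variable [HasDerivedCategory.{w} X₀.left.Modules]

/-- Conjugating `Hom(A′, A′⟦n⟧)` by an isomorphism `e : A′ ≅ A″` is a bijection onto `Hom(A″, A″⟦n⟧)`. [folklore] -/
theorem conj_shift_bijective {D : Type*} [Category D] [Preadditive D] [HasShift D ℤ] {A' A'' : D} (e : A' ≅ A'')
    (n : ℤ) : Function.Bijective (fun y : A' ⟶ A'⟦n⟧ => e.inv ≫ y ≫ (shiftFunctor D n).map e.hom) := by
  refine Function.bijective_iff_has_inverse.mpr ⟨fun y' => e.hom ≫ y' ≫ (shiftFunctor D n).map e.inv, ?_, ?_⟩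
  · intro y
    simp only [Category.assoc, Iso.hom_inv_id_assoc, ← Functor.map_comp, Iso.hom_inv_id]
    rw [CategoryTheory.Functor.map_id, Category.comp_id]
  · intro y'
    simp only [Category.assoc, Iso.inv_hom_id_assoc, ← Functor.map_comp, Iso.inv_hom_id]
    rw [CategoryTheory.Functor.map_id, Category.comp_id]

/-- **`θ₀ : Hom_{D(X₀)}(Q E₀, (Q E₀)⟦n⟧) ≃ Hom_{D(X₀)}(Q(E₀ ⊗ M), Q(E₀ ⊗ M)⟦n⟧)`, CONSTRUCTED**: `x ↦ Ψ x ≫ (Ψ.commShiftIso n)`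
for `Ψ = D(- ⊗ M)` (bijective, `twist_theta_bijective`), conjugated by Mathlib's canonical isomorphism
`Ψ(Q E₀) ≅ Q((- ⊗ M) E₀)` (`Functor.mapDerivedCategoryFactors`). This is the «additive bijection `θ` (intended: induced by
`D(- ⊗ M_B)`; existence not asserted)» of `UntwistComplexSigma` §4 — now a definition. [folklore] -/
noncomputable def twistTheta (n : ℤ) :
    (DerivedCategory.Q.obj E₀ ⟶ (DerivedCategory.Q.obj E₀)⟦n⟧) ≃+
      (DerivedCategory.Q.obj (cocycleTwistComplex c E₀) ⟶ (DerivedCategory.Q.obj (cocycleTwistComplex c E₀))⟦n⟧) :=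
  AddEquiv.ofBijective
    ((Preadditive.leftComp _ ((twistEquivalence X₀.left c).functor.mapDerivedCategoryFactors.app E₀).inv).comp
      ((Preadditive.rightComp _
          ((shiftFunctor _ n).map ((twistEquivalence X₀.left c).functor.mapDerivedCategoryFactors.app E₀).hom)).comp
        ((Preadditive.rightComp _
            (((twistEquivalence X₀.left c).functor.mapDerivedCategory.commShiftIso n).app _).hom).comp
          (twistEquivalence X₀.left c).functor.mapDerivedCategory.mapAddHom)))
    ((conj_shift_bijective ((twistEquivalence X₀.left c).functor.mapDerivedCategoryFactors.app E₀) n).comp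
      (twist_theta_bijective c _ _ n))

/-- The formula for `θ₀`. [folklore] -/
theorem twistTheta_apply (n : ℤ) (x : DerivedCategory.Q.obj E₀ ⟶ (DerivedCategory.Q.obj E₀)⟦n⟧) :
    twistTheta c E₀ n x =
      ((twistEquivalence X₀.left c).functor.mapDerivedCategoryFactors.app E₀).inv ≫
        ((twistEquivalence X₀.left c).functor.mapDerivedCategory.map x ≫
          (((twistEquivalence X₀.left c).functor.mapDerivedCategory.commShiftIso n).app _).hom) ≫
        (shiftFunctor _ n).map ((twistEquivalence X₀.left c).functor.mapDerivedCategoryFactors.app E₀).hom :=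
  rfl

variable (a b : ℤ) [E₀.IsStrictlyGE a] [E₀.IsStrictlyLE b] (hK : ∀ p, IsFiniteLocallyFree (E₀.X p))

/-- **R1.0 in the untwisted reading, BOTH sides the tree's real predicate, `θ₀` CONSTRUCTED, `E₀ ⊗ M` strictly perfect
PROVED** (file #10 §4 `isISemiregularC_iff_isISemiregularC_of_triangular` at `E₀′ := E₀ ⊗ M` termwise, `θ := twistTheta`,
`d = id`): for a STRICTLY PERFECT `E₀` (terms finite locally free in `[a, b]`; intended the two-term locally free
representative of `Φ(I_p ⊠ I_q)`) and the REAL families `HomComplex.sigmaC` of `E₀` and of `E₀ ⊗ M`, GIVEN ONLY the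
triangular re-expansion `hσ` through `θ₀` (the Leibniz rule; `u` arbitrary):
`IsISemiregularC X₀ E₀ a b hK I ↔ IsISemiregularC X₀ (E₀ ⊗ M) a b _ I` for every lower set `I` (FULL semiregularity:
`I = univ`). [cite: BuchweitzFlenner2003, Def. 4.1 and §5; Atiyah1957, Prop. 10–12] -/
theorem isISemiregularC_iff_isISemiregularC_twist
    (u : ∀ q j, ShiftedHom (DerivedCategory.Q.obj ((HomologicalComplex.single X₀.left.Modules (ComplexShape.up ℤ) 0).obj
        (unitModule X₀.left))) (DerivedCategory.Q.obj ((HomologicalComplex.single X₀.left.Modules (ComplexShape.up ℤ)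
        0).obj (hodgeSheaf X₀ j))) ((j + 2 : ℕ) : ℤ) →+
      ShiftedHom (DerivedCategory.Q.obj ((HomologicalComplex.single X₀.left.Modules (ComplexShape.up ℤ) 0).obj
        (unitModule X₀.left))) (DerivedCategory.Q.obj ((HomologicalComplex.single X₀.left.Modules (ComplexShape.up ℤ)
        0).obj (hodgeSheaf X₀ q))) ((q + 2 : ℕ) : ℤ))
    {I : Set ℕ} (hI : IsLowerSet I)
    (hσ : ∀ q ∈ I, ∀ x : DerivedCategory.Q.obj E₀ ⟶ (DerivedCategory.Q.obj E₀)⟦(2 : ℤ)⟧,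
      HomComplex.sigmaC X₀ (cocycleTwistComplex c E₀) a b (isFiniteLocallyFree_cocycleTwistComplex_X c hK) q (twistTheta c E₀ 2 x) =
        HomComplex.sigmaC X₀ E₀ a b hK q x + ∑ j ∈ Finset.range q, u q j (HomComplex.sigmaC X₀ E₀ a b hK j x)) :
    HomComplex.IsISemiregularC X₀ E₀ a b hK I ↔
      HomComplex.IsISemiregularC X₀ (cocycleTwistComplex c E₀) a b (isFiniteLocallyFree_cocycleTwistComplex_X c hK) I :=
  isISemiregularC_iff_isISemiregularC_of_triangular E₀ (cocycleTwistComplex c E₀) a b a b hK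
    (isFiniteLocallyFree_cocycleTwistComplex_X c hK) (twistTheta c E₀ 2) (fun _ => AddMonoidHom.id _) u hI
    (fun _ _ => Function.injective_id) fun q hq x => hσ q hq x

end ComplexBothSides

end Summit.Ventures.HSemireg
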